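import Literature.AlgebraicGeometry.HodgeTheory.UnitaryReflectionGroupZariskiDense
import HarnessLib

/-!
# Complex reflections under rescaling of the root by a phase and under unitary conjugation
# (Carlson–Toledo 1999, §7: `s_{uδ} = u s_δ u⁻¹`; the reflection only depends on the line `ℂδ` and `h(δ,δ)`)

Family `hodge`, layer `Literature/AlgebraicGeometry/HodgeTheory`. THEOREMS only, for crux K1 of
`Summits/HodgeConjecture/HodgeConjecture/Theses/CyclicUnitaryPowers.lean` (lane D glue, hole S3: identifying the
group generated by the blocks of the monodromy generators with the group generated by the reflections along ONE
orbit `Γ_i · δ̂₀` — roots that differ by a phase give the same reflection, and translating the root by a unitary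
element conjugates the reflection).
* `complexReflection_smul_root` — `s_{cδ} = s_δ` for `c̄c = 1`;
* `complexReflection_apply_unitary` / `comp_complexReflection_unitary` — `s_{uδ} (u y) = u (s_δ y)`, i.e.
  `s_{uδ} ∘ u = u ∘ s_δ` for `h`-unitary `u`;
* `coe_conj_eq_complexReflection` — in `GL(W)`: if `↑g = s_δ` then `↑(u g u⁻¹) = s_{uδ}`.
Written by the prover seat `hodge-nonav-prover-Ax`.

## References
* [CarlsonToledo1999] J. A. Carlson, D. Toledo, Duke Math. J. 97 (1999), §7 (reflectionconjugacy, p. 15) and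
  Theorem udensitytheo.
-/

noncomputable section

open Module

namespace Literature.AlgebraicGeometry.HodgeTheory

variable {W : Type*} [AddCommGroup W] [Module ℂ W]

/-- **`s_{cδ} = s_δ` for a phase `c` (`c̄ c = 1`)**: the complex reflection only depends on the root up to
unit scalars. [cite: CarlsonToledo1999, §7 Theorem udensitytheo] -/
theorem complexReflection_smul_root (B : W →ₗ⋆[ℂ] W →ₗ[ℂ] ℂ) (ε l : ℂ) {c : ℂ} (hc : starRingEnd ℂ c * c = 1)
    (δ : W) : complexReflection B ε l (c • δ) = complexReflection B ε l δ := by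
  ext y
  rw [complexReflection_apply, complexReflection_apply, LinearMap.map_smulₛₗ, LinearMap.smul_apply, smul_eq_mul,
    smul_smul]
  congr 2
  linear_combination (ε * (l - 1) * B δ y) * hc

/-- **`s_{uδ}(u y) = u (s_δ y)`** for an `h`-unitary automorphism `u`. [cite: CarlsonToledo1999, §7 (reflectionconjugacy), p. 15] -/
theorem complexReflection_apply_unitary (B : W →ₗ⋆[ℂ] W →ₗ[ℂ] ℂ) (u : W ≃ₗ[ℂ] W)
    (hu : ∀ x y, B (u x) (u y) = B x y) (ε l : ℂ) (δ y : W) :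
    complexReflection B ε l (u δ) (u y) = u (complexReflection B ε l δ y) := by
  have h := complexReflection_conj B u hu ε l (u δ) y
  rw [LinearEquiv.symm_apply_apply] at h
  rw [← h, LinearEquiv.apply_symm_apply]

/-- `s_{uδ} ∘ u = u ∘ s_δ` as linear maps. [cite: CarlsonToledo1999, §7 (reflectionconjugacy), p. 15] -/
theorem comp_complexReflection_unitary (B : W →ₗ⋆[ℂ] W →ₗ[ℂ] ℂ) (u : W ≃ₗ[ℂ] W)
    (hu : ∀ x y, B (u x) (u y) = B x y) (ε l : ℂ) (δ : W) :
    complexReflection B ε l (u δ) ∘ₗ (u : W →ₗ[ℂ] W) = (u : W →ₗ[ℂ] W) ∘ₗ complexReflection B ε l δ :=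
  LinearMap.ext fun y => complexReflection_apply_unitary B u hu ε l δ y

/-- **Conjugating a reflection in `GL(W)`**: if `g ∈ GL(W)` has underlying map `s_δ` and `u` is `h`-unitary, then
`u g u⁻¹` has underlying map `s_{uδ}`. [cite: CarlsonToledo1999, §7 (reflectionconjugacy), p. 15] -/
theorem coe_conj_eq_complexReflection (B : W →ₗ⋆[ℂ] W →ₗ[ℂ] ℂ) {u g : W ≃ₗ[ℂ] W}
    (hu : ∀ x y, B (u x) (u y) = B x y) {ε l : ℂ} {δ : W} (hg : (g : W →ₗ[ℂ] W) = complexReflection B ε l δ) :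
    ((u * g * u⁻¹ : W ≃ₗ[ℂ] W) : W →ₗ[ℂ] W) = complexReflection B ε l (u δ) := by
  refine LinearMap.ext fun y => ?_
  have h1 : ((u * g * u⁻¹ : W ≃ₗ[ℂ] W) : W →ₗ[ℂ] W) y = u (g (u.symm y)) := rfl
  rw [h1, ← LinearEquiv.coe_coe g, hg, ← complexReflection_apply_unitary B u hu, LinearEquiv.apply_symm_apply]

/-- Membership form: the set of automorphisms whose underlying map is a reflection along a root in a `u`-stable
set is stable under conjugation by the unitary `u`. [cite: CarlsonToledo1999, §7 Theorem udensitytheo] -/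
theorem conj_mem_setOf_coe_eq_complexReflection (B : W →ₗ⋆[ℂ] W →ₗ[ℂ] ℂ) {Δ : Set W} {u : W ≃ₗ[ℂ] W}
    (hu : ∀ x y, B (u x) (u y) = B x y) (hΔ : ∀ δ ∈ Δ, u δ ∈ Δ) (ε l : ℂ) {g : W ≃ₗ[ℂ] W}
    (hg : g ∈ {g : W ≃ₗ[ℂ] W | ∃ δ ∈ Δ, (g : W →ₗ[ℂ] W) = complexReflection B ε l δ}) :
    u * g * u⁻¹ ∈ {g : W ≃ₗ[ℂ] W | ∃ δ ∈ Δ, (g : W →ₗ[ℂ] W) = complexReflection B ε l δ} := by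
  obtain ⟨δ, hδ, hgδ⟩ := hg
  exact ⟨u δ, hΔ δ hδ, coe_conj_eq_complexReflection B hu hgδ⟩

end Literature.AlgebraicGeometry.HodgeTheory

end
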